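import Mathlib.Algebra.Group.Submonoid.Operations
import Mathlib.Algebra.Group.Pi.Lemmas
import Literature.IUT.HodgeArakelov.TemperedThetaMonoidsProofs
import Literature.IUT.HodgeArakelov.GaussianMonoidsGood

/-!
# [IUTchII] Cor 3.5 (ii)/(iii), Cor 3.6 (ii)/(iii): Galois compatibility of the restriction, splitting
# compatibility, and the Kummer–restriction–transport composite — proof companion no. 3 of
# `BadPrimeGaussianMonoids.lean`

S. Mochizuki, *Inter-universal Teichmüller theory II*, §3, kurims Dec-2020 manuscript: Cor 3.5 (ii), (iii)
pp. 94–95, Cor 3.6 (ii), (iii) pp. 99–101, Remark 3.6.1 p. 101 [cite: Mochizuki2012, Cor 3.5 p.93]. Claim key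
DISPUTED (D-0012). PROOF-ONLY companion (abc-iut cell, layer L6, seat abc-iut-w4-d004; continuation of
DISCHARGE-L6 §F row F1 / `BadPrimeGaussianMonoidsProofs2.lean`; nodes IUTchII:Cor3.5(ii), IUTchII:Cor3.5(iii),
IUTchII:Cor3.6(ii), IUTchII:Cor3.6(iii)). NO definition, NO `Prop` fact; theorems over the REAL objects of
abc-iut-L6-t2 / -d3 (`splitMonoid`, `TemperedThetaMonoids.ThetaEnvData`, `TemperedFrobenioidThetaData`,
`Prop33KummerStatements`, `gaussianMonoid`, `unitDiagonal`, `frobenioidGaussianMonoid`, `piIso`).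

* **Cor 3.5 (ii) "⥤" / Remark 3.6.1 (Galois compatibility).** In print: "the compatibility of the action of
  `G_v(M^Θ_*▶)_{|t|}` on the factor labeled `|t|` … with the inclusions `G_v(M^Θ_*) ↪ Π_{v▶}(M^Θ_*▶)` determined
  by the various choices of the `D^δ_{t,μ_-}` that gave rise to the value-profile `ξ`", and "each `Ψ_ξ(M^Θ_*)`
  is equipped with a natural action by `G_v(M^Θ_*▶)_{⟨F_l^⋇⟩}`". Over the conjugation action `Π_X(M^Θ_*) ↷ H`
  (t2's `ThetaEnvData.conj`), sections `s_t : G → Π_X` (the inclusions determined by the `D^δ_{t,μ_-}`), an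
  action `β` of `G` on the labeled copies, and restriction morphisms `r_t` that are EQUIVARIANT along `s_t`
  (functoriality of restriction under conjugation), we PROVE: if the `G`-actions through the various `s_t`
  AGREE on the theta monoid (conjugate synchronization, Cor 3.5 (i) / Remark 3.5.2 — a named hypothesis
  here), then restriction intertwines the `G`-action on `Ψ^ι_env` with the DIAGONAL action on `∏_t Ψ_cns,t`
  (`pi_conj_eq_piIso`), the image `Ψ_ξ` is stable under the diagonal action (`map_pi_diagonalStable`: "equipped
  with a natural action by `G_v,⟨F_l^⋇⟩`"), and the restriction isomorphism `Ψ^ι_env ⥲ Ψ_ξ` of Proofs2 is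
  `G`-equivariant (`restrictionIso_equivariant`).
* **Cor 3.5 (iii) / 3.6 (iii) (splittings).** "a splitting up to torsion of each of the Gaussian monoids
  `Ψ_ξ = Ψ^×_{⟨F_l^⋇⟩} · ξ^ℕ` … compatible, relative to the restriction isomorphisms …, with the splittings up to
  torsion of Proposition 3.1, (i)": restriction carries the unit factor `M^×_TM` ONTO the unit diagonal and
  the factor `θ^ℕ` ONTO `ξ^ℕ` (`map_units_eq_unitDiagonal`, `map_powers_theta`), and the Frobenioid-theoretic
  transport carries `ξ^ℕ` to `Im(ξ)^ℕ` (`comap_piIso_powers`; the unit factor is t2's `frobenioidGaussianMonoid_eq`).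
* **Cor 3.6 (ii) (the Kummer–restriction–transport diagram).** "by composing the Kummer isomorphisms … of
  Proposition 3.3, (i), (ii), with the restriction isomorphisms of Corollary 3.5, (ii), one obtains a diagram
  of compatible morphisms `Ψ_{†F^Θ_v,α} ⥲ Ψ^ι_env(M^Θ_*) ⥲ Ψ_ξ(M^Θ_*) ⥲ Ψ_{F_ξ}(†F_v)` … isomorphisms": from t2's REAL
  Kummer datum `Prop33KummerStatements.kummerTheta` and a restriction isomorphism as produced in Proofs2
  (`exists_unique_restrictionIso_thetaMonoid`), the COMPOSITE isomorphism `Ψ_{†F^Θ_v,α} ⥲ Ψ_{F_ξ}(†F_v)` exists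
  and is pinned: its underlying map, read back through the labeled Kummer copies `piIso`, IS "restriction ∘
  Kummer" (`exists_kummerRestrictionTransportIso`).

Nothing here asserts a disputed claim or takes a side on [IUTchIII] Cor 3.12; typed ≠ proved ≠ endorsed.
-/

namespace Literature.IUT.HodgeArakelov

namespace BadPrimeGaussianMonoids

open TemperedThetaMonoids

universe u v w

/-! ### 1. Cor 3.5 (ii) "⥤" / Remark 3.6.1: Galois compatibility modulo conjugate synchronization -/

section Galois

variable {H : Type u} [CommGroup H] {T : Type v} {M : Type w} [CommMonoid M]
  {G : Type*} [Group G] {P : Type*} [Group P]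
  (conj : P →* MulAut H) (s : T → (G →* P)) (β : G →* MulAut M) (r : T → (H →* M))

/-- **IUTchII:Cor3.5(ii)** (kurims p.95) "⥤", equivariance of restriction: if each `r_t` is equivariant along
the inclusion `s_t : G_v ↪ Π_X` it was restricted along ("compatibility … with the inclusions … determined by
the various choices of the `D^δ_{t,μ_-}`") and the resulting `G_v`-actions AGREE on a submonoid `S`
(conjugate synchronization, Cor 3.5 (i)), then on `S` the product of the restrictions intertwines the
`G_v`-action through any one `s_{t₀}` with the DIAGONAL action `G_v,⟨F_l^⋇⟩` on the labeled copies.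
[cite: Mochizuki2012, Cor 3.5 (ii) p.95] -/
theorem pi_conj_eq_piIso (hr : ∀ t g x, r t (conj (s t g) x) = β g (r t x)) (S : Submonoid H)
    (hsync : ∀ g t t', ∀ x ∈ S, conj (s t g) x = conj (s t' g) x) (t₀ : T) (g : G) {x : H}
    (hx : x ∈ S) : MonoidHom.pi r (conj (s t₀ g) x) = piIso T (β g) (MonoidHom.pi r x) := by
  funext t
  rw [MonoidHom.pi_apply, hsync g t₀ t x hx, hr]
  rfl

/-- **IUTchII:Cor3.5(ii)** (kurims p.95) "each `Ψ_ξ(M^Θ_*)` is equipped with a natural action by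
`G_v(M^Θ_*▶)_{⟨F_l^⋇⟩}`": under equivariance and conjugate synchronization, and stability of `S` (e.g.
`S = Ψ^ι_env`) under the `G_v`-actions, the IMAGE of `S` under restriction — the Gaussian monoid `Ψ_ξ` in the
situation of Proofs2 — is stable under the diagonal action. [cite: Mochizuki2012, Cor 3.5 (ii) p.95] -/
theorem map_pi_diagonalStable (hr : ∀ t g x, r t (conj (s t g) x) = β g (r t x)) (S : Submonoid H)
    (hsync : ∀ g t t', ∀ x ∈ S, conj (s t g) x = conj (s t' g) x)
    (hstab : ∀ g t, ∀ x ∈ S, conj (s t g) x ∈ S) (t₀ : T) (g : G) :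
    (S.map (MonoidHom.pi r)).map (piIso T (β g)).toMonoidHom = S.map (MonoidHom.pi r) := by
  apply le_antisymm
  · rintro _ ⟨_, ⟨x, hx, rfl⟩, rfl⟩
    exact ⟨conj (s t₀ g) x, hstab g t₀ x hx, pi_conj_eq_piIso conj s β r hr S hsync t₀ g hx⟩
  · rintro _ ⟨x, hx, rfl⟩
    refine ⟨MonoidHom.pi r (conj (s t₀ g⁻¹) x), ⟨_, hstab g⁻¹ t₀ x hx, rfl⟩, ?_⟩
    rw [pi_conj_eq_piIso conj s β r hr S hsync t₀ g⁻¹ hx, map_inv]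
    exact (piIso T (β g)).apply_symm_apply _

/-- **IUTchII:Rmk3.6.1** (kurims p.101) "The «Galois compatibility» … corresponds precisely to the «Galois
functoriality» … of Remark 1.12.4": any restriction ISOMORPHISM `e : S ⥲ Ψ_ξ` whose underlying map is the
restriction (Proofs2 `exists_restrictionIso`) is `G_v`-equivariant for the action through `s_{t₀}` on `S` and
the diagonal action on `Ψ_ξ` (equality of underlying families). [cite: Mochizuki2012, Rmk 3.6.1 p.101] -/
theorem restrictionIso_equivariant (hr : ∀ t g x, r t (conj (s t g) x) = β g (r t x)) (S : Submonoid H)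
    (hsync : ∀ g t t', ∀ x ∈ S, conj (s t g) x = conj (s t' g) x)
    (hstab : ∀ g t, ∀ x ∈ S, conj (s t g) x ∈ S) {S' : Submonoid (T → M)} (e : S ≃* S')
    (he : ∀ x : S, ((e x : S') : T → M) = MonoidHom.pi r x) (t₀ : T) (g : G) (x : S) :
    ((e ⟨conj (s t₀ g) x, hstab g t₀ x x.2⟩ : S') : T → M) = piIso T (β g) (e x : T → M) := by
  rw [he, he]
  exact pi_conj_eq_piIso conj s β r hr S hsync t₀ g x.2

end Galois

/-! ### 2. Cor 3.5 (iii) / 3.6 (iii): compatibility of the splittings up to torsion -/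

section Splittings

variable {H : Type u} [CommGroup H] {T : Type v} {M : Type w} [CommMonoid M] {N : Type*} [CommMonoid N]

/-- **IUTchII:Cor3.5(iii)** (kurims p.95) "a splitting up to torsion of each of the Gaussian monoids
`Ψ_ξ(M^Θ_*) = Ψ^×_cns(M^Θ_*)_{⟨F_l^⋇⟩} · ξ^ℕ` … compatible, relative to the restriction isomorphisms …, with the
splittings up to torsion of Proposition 3.1, (i)", unit factor: restriction carries `M^×_TM` ONTO the unit
diagonal (hypotheses as in Proofs2 `map_thetaSplit_eq_gaussianMonoid`). [cite: Mochizuki2012, Cor 3.5 (iii) p.95] -/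
theorem map_units_eq_unitDiagonal (U : Subgroup H) (r : T → (H →* M))
    (hU : ∀ u ∈ U, ∃ m : Mˣ, ∀ t, r t u = m) (hUsurj : ∀ m : Mˣ, ∃ u ∈ U, ∀ t, r t u = m) :
    U.toSubmonoid.map (MonoidHom.pi r) = unitDiagonal T M := by
  apply le_antisymm
  · rintro _ ⟨u, hu, rfl⟩
    obtain ⟨m, hm⟩ := hU u hu
    exact ⟨m, funext fun t => by rw [MonoidHom.pi_apply, hm t]⟩
  · rintro _ ⟨m, rfl⟩
    obtain ⟨u, hu, hm⟩ := hUsurj m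
    exact ⟨u, hu, funext fun t => by rw [MonoidHom.pi_apply, hm t]⟩

/-- **IUTchII:Cor3.5(iii)** (kurims p.95), theta factor: restriction carries `θ^ℕ` ONTO `ξ^ℕ`, `ξ = (r_t θ)_t`.
[cite: Mochizuki2012, Cor 3.5 (iii) p.95] -/
theorem map_powers_theta (θ : H) (r : T → (H →* M)) :
    (Submonoid.powers θ).map (MonoidHom.pi r) = Submonoid.powers (fun t => r t θ) := by
  rw [Submonoid.map_powers]
  rfl

/-- **IUTchII:Cor3.6(iii)** (kurims p.100) "splittings up to torsion of each of the [Frobenioid-theoretic]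
Gaussian monoids `Ψ_{F_ξ}(†F_v) = (Ψ^×_{†C_v})_{⟨F_l^⋇⟩} · Im(ξ)^ℕ` … compatible … with the splittings … of
Corollary 3.5, (iii)", theta factor: the labeled Kummer copies pull `ξ^ℕ` back to `Im(ξ)^ℕ`, `Im(ξ) = e⁻¹ ∘ ξ`
(the unit factor and the whole monoid are t2's `frobenioidGaussianMonoid_eq`). [cite: Mochizuki2012, Cor 3.6 (iii) p.100] -/
theorem comap_piIso_powers (e : N ≃* M) (ξ : T → M) :
    (Submonoid.powers ξ).comap (piIso T e).toMonoidHom = Submonoid.powers (fun t => e.symm (ξ t)) := by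
  have hξ : ξ = piIso T e (fun t => e.symm (ξ t)) := funext fun t => (e.apply_symm_apply (ξ t)).symm
  ext x
  rw [Submonoid.mem_comap, Submonoid.mem_powers_iff, Submonoid.mem_powers_iff]
  constructor
  · rintro ⟨n, hn⟩
    refine ⟨n, (piIso T e).injective ?_⟩
    rw [map_pow, ← hξ]
    exact hn
  · rintro ⟨n, rfl⟩
    refine ⟨n, ?_⟩
    change ξ ^ n = piIso T e ((fun t => e.symm (ξ t)) ^ n)
    rw [map_pow, ← hξ]

end Splittings

/-! ### 3. Cor 3.6 (ii): the composite `Ψ_{†F^Θ_v,α} ⥲ Ψ^ι_env(M^Θ_*) ⥲ Ψ_ξ(M^Θ_*) ⥲ Ψ_{F_ξ}(†F_v)` -/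

section KummerDiagram

variable {P : Type u} [Group P] {E : TemperedThetaMonoids.ThetaEnvData.{u, v} P}
  {F : TemperedFrobenioidThetaData.{u, v} P} (K : Prop33KummerStatements E F)
  {T : Type w} {M : Type*} [CommMonoid M] {N : Type*} [CommMonoid N]

/-- **IUTchII:Cor3.6(ii)** (kurims p.100) transport half: the labeled Kummer copies `piIso T e` restrict to an
isomorphism of the Frobenioid-theoretic Gaussian monoid `Ψ_{F_ξ}(†F_v)` — DEFINED in the statement file as the
pull-back of `Ψ_ξ` — onto `Ψ_ξ`, with underlying map `piIso T e`. [cite: Mochizuki2012, Cor 3.6 (ii) p.100] -/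
theorem exists_transportIso (e : N ≃* M) (ξ : T → M) :
    ∃ ψ : frobenioidGaussianMonoid e ξ ≃* gaussianMonoid ξ,
      ∀ x, ((ψ x : gaussianMonoid ξ) : T → M) = piIso T e x := by
  have hmap : (frobenioidGaussianMonoid e ξ).map (piIso T e : (T → N) →* (T → M)) = gaussianMonoid ξ := by
    rw [frobenioidGaussianMonoid, MulEquiv.toMonoidHom_eq_coe, Submonoid.map_comap_eq_of_surjective]
    exact (piIso T e).surjective
  exact ⟨((piIso T e).submonoidMap (frobenioidGaussianMonoid e ξ)).trans (MulEquiv.submonoidCongr hmap),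
    fun x => rfl⟩

/-- **IUTchII:Cor3.6(ii)** (kurims p.100) "by composing the Kummer isomorphisms … of Proposition 3.3, (i), (ii),
with the restriction isomorphisms of Corollary 3.5, (ii), one obtains a diagram of compatible morphisms
`Ψ_{†F^Θ_v,α} ⥲ Ψ^ι_env(M^Θ_*) ⥲ Ψ_ξ(M^Θ_*) ⥲ Ψ_{F_ξ}(†F_v)` … isomorphisms of monoids": given the REAL Kummer
isomorphism `kummerTheta α : Ψ_{†F^Θ_v,α} ⥲ Ψ^ι_env` (t2's `Prop33KummerStatements`) and a restriction
isomorphism `Ψ^ι_env ⥲ Ψ_ξ` whose underlying map is the restriction (Proofs2), the COMPOSITE isomorphism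
`Ψ_{†F^Θ_v,α} ⥲ Ψ_{F_ξ}(†F_v)` exists and is pinned: read through the labeled Kummer copies `piIso T e`
(`(Ψ_{†C_v})_t ⥲ Ψ_cns,t`) it IS "restriction ∘ Kummer". [cite: Mochizuki2012, Cor 3.6 (ii) p.100] -/
theorem exists_kummerRestrictionTransportIso (α : P) (r : T → (E.H →* M)) {ξ : T → M}
    (eΨ : E.thetaMonoid (K.label α) ≃* gaussianMonoid ξ)
    (heΨ : ∀ y, ((eΨ y : gaussianMonoid ξ) : T → M) = MonoidHom.pi r y) (e : N ≃* M) :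
    ∃ Φ : F.frobThetaMonoid α ≃* frobenioidGaussianMonoid e ξ,
      ∀ x, piIso T e ((Φ x : frobenioidGaussianMonoid e ξ) : T → N) =
        MonoidHom.pi r ((K.kummerTheta α x : E.thetaMonoid (K.label α)) : E.H) := by
  obtain ⟨ψ, hψ⟩ := exists_transportIso e ξ
  refine ⟨(K.kummerTheta α).trans (eΨ.trans ψ.symm), fun x => ?_⟩
  rw [MulEquiv.trans_apply, MulEquiv.trans_apply, ← hψ, MulEquiv.apply_symm_apply, heΨ]

end KummerDiagram

end BadPrimeGaussianMonoids

end Literature.IUT.HodgeArakelov
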